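import Literature.AlgebraicGeometry.Resolution.BertiniAffine
import HarnessLib

/-!
# Crux `EquisingularLift` (stmt-ResolutionOfSingularities-15660), line `Sketch`:
# Bertini with a base curve — the fibre count at a bad closed point

[OURS · L1 W4.5b] Support file for the registered stub `stub_bertiniWithBaseCurve` of
`Cruxes/EquisingularLift/Lines/Sketch.lean` (idea card `linked-ci-centres`, lemma 1); NOT a statement
of any manuscript.

Setting of `Literature/AlgebraicGeometry/Resolution/BertiniAffine.lean` (Hartshorne II.8.18 in affine
local-algebra form): `A` a regular algebra of finite type over an algebraically closed field `k`,
`u : ι → A` finitely many functions, `s_t = Σ tⱼ uⱼ`, `B = A[a]/(Σ aⱼ uⱼ)` the incidence ring over the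
parameter ring `k[a]`, `𝔔_{t,𝔪}` its closed points. The tree's dimension count
(`BertiniAffine.under_paramRing_ne_bot`) assumes that `t ↦ s_t mod 𝔪²` is SURJECTIVE at every closed
point `𝔪`. Here the linear system may have a BASE CURVE `Σ = V(𝔭)` (`dim A/𝔭 ≤ 1`): off `Σ` the
map `t ↦ s_t mod 𝔪²` is surjective, on `Σ` its range has rank `≥ 2`. The count still shows that no
component of the bad locus `{(t, 𝔪) | s_t ∈ 𝔪²}` dominates the parameter space:

* `height_map_mk_fibre_add_finrank_le` — the fibre count at ONE bad closed point `(t, 𝔪)` above a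
  prime `𝔔̃ ⊆ A[a]` all of whose closed points are bad: the closed point `𝔐̃ = (𝔪, a - t)` has height
  `≤ |ι| - rank (t ↦ s_t mod 𝔪²)` in `A[a] ⧸ (𝔔̃ + 𝔪A[a])` (Hartshorne's linear-algebra count, extracted
  from the tree's proof and stated for the RANGE of `t ↦ s_t mod 𝔪²` instead of assuming surjectivity);
* the count itself (`under_paramRing_ne_bot_baseCurve`) is in the sibling file
  `EquisingularLiftEquisingularLiftBertiniBaseCurveCount.lean`.

References: Hartshorne, *Algebraic Geometry*, II Thm. 8.18 (proof); Matsumura, *Commutative Ring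
Theory*, Thm. 15.1; the base-locus variant is classical (Altman–Kleiman, *Bertini theorems for
hypersurface sections containing a subscheme*, Comm. Algebra 7 (1979)).
-/

set_option linter.dupNamespace false -- mandated namespace `Summit.<Summit>.<Problem>` of this single-conjunct summit

noncomputable section

open IsLocalRing MvPolynomial

universe u v

namespace Summit.ResolutionOfSingularities.ResolutionOfSingularities.Cruxes.EquisingularLift.StrataSplit

open Literature.AlgebraicGeometry.Resolution Literature.AlgebraicGeometry.Resolution.BertiniAffine

variable {k : Type u} [Field k] {A : Type u} [CommRing A] [Algebra k A]
variable {ι : Type v} [Fintype ι] (u : ι → A)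

set_option synthInstance.maxHeartbeats 80000 in
set_option maxHeartbeats 1600000 in
/-- **The fibre count at a bad closed point** (Hartshorne's proof of II.8.18, linear-algebra half,
for the RANGE of `t ↦ s_t mod 𝔪²`). Let `𝔔̃ ⊆ A[a]` be a prime all of whose closed points are of the
form `(𝔪', a - t')` with `s_{t'} ∈ 𝔪'²`, and `𝔐̃ = (𝔪, a - t) ⊇ 𝔔̃` one of them. Then in
`A[a] ⧸ (𝔔̃ + 𝔪A[a])` the image of `𝔐̃` has height `≤ |ι| - rank_k (t ↦ s_t mod 𝔪²)`: every closed
point of `V(𝔔̃ + 𝔪A[a])` is `(𝔪, a - t')` with `t'` in the kernel `K` of `t ↦ s_t mod 𝔪²`, so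
(Jacobson) `V(𝔔̃ + 𝔪A[a])` lies in the linear space cut out by the `rank` relations dual to the
range, modulo which `𝔐̃` needs only `|ι| - rank` generators (Krull's height theorem).
[cite: Hartshorne1977, II.8.18 (proof)] -/
theorem height_map_mk_fibre_add_finrank_le [IsAlgClosed k] [Algebra.FiniteType k A]
    (𝔔t : Ideal (MvPolynomial ι A)) [𝔔t.IsPrime]
    (hclosed : ∀ 𝔐' : Ideal (MvPolynomial ι A), 𝔐'.IsMaximal → 𝔔t ≤ 𝔐' →
      ∃ (t' : ι → k) (𝔪' : Ideal A), 𝔪'.IsMaximal ∧ linComb u t' ∈ 𝔪' ^ 2 ∧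
        𝔐' = 𝔪'.comap (evalPoly (A := A) t').toRingHom)
    (𝔐t : Ideal (MvPolynomial ι A)) (h𝔐tmax : 𝔐t.IsMaximal) (h𝔔𝔐t : 𝔔t ≤ 𝔐t)
    {𝔪 : Ideal A} [h𝔪max : 𝔪.IsMaximal] {t : ι → k} (hst2 : linComb u t ∈ 𝔪 ^ 2)
    (h𝔐teq : 𝔐t = 𝔪.comap (evalPoly (A := A) t).toRingHom) :
    (𝔐t.map (Ideal.Quotient.mk (𝔔t ⊔ 𝔪.map (C : A →+* MvPolynomial ι A)))).height +
        (Module.finrank k (LinearMap.range (linCombQuotSq (k := k) u 𝔪)) : ℕ∞) ≤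
      (Fintype.card ι : ℕ∞) := by
  classical
  let At := MvPolynomial ι A
  haveI : IsNoetherianRing A := Algebra.FiniteType.isNoetherianRing k A
  haveI : IsJacobsonRing A := isJacobsonRing_of_finiteType (A := k)
  haveI : IsJacobsonRing At := inferInstance
  -- relations and free coordinates for the range of `Λ : t ↦ s_t mod 𝔪²`
  set Λ := linCombQuotSq (k := k) u 𝔪 with hΛdef
  obtain ⟨R₀, S, hcard, hperp', hspan⟩ :=
    exists_relations_and_coordinates Λ.rangeRestrict Λ.surjective_rangeRestrict
  have hperp : ∀ c ∈ R₀, ∀ t' ∈ LinearMap.ker Λ, ∑ j, c j * t' j = 0 := by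
    intro c hc t' ht'
    exact hperp' c hc t' (by rwa [LinearMap.ker_rangeRestrict])
  have hkerK : ∀ t' : ι → k, linComb u t' ∈ 𝔪 ^ 2 → t' ∈ LinearMap.ker Λ := by
    intro t' ht'
    rw [LinearMap.mem_ker, hΛdef, linCombQuotSq_apply]
    exact Ideal.Quotient.eq_zero_iff_mem.2 ht'
  -- the auxiliary ideal `J̃ = 𝔪At + (linear relations)`
  let gv : ι → At := fun j => X j - C (algebraMap k A (t j))
  have hgv : ∀ (t' : ι → k) (j : ι), X j - C (algebraMap k A (t' j)) ∈
      (Ideal.comap (evalPoly (A := A) t').toRingHom 𝔪 : Ideal At) := by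
    intro t' j
    rw [Ideal.mem_comap]
    change evalPoly t' (X j - C (algebraMap k A (t' j))) ∈ 𝔪
    rw [map_sub, evalPoly_X, evalPoly_C, sub_self]
    exact zero_mem _
  let Lf : (ι → k) → At := fun c => ∑ j, c j • (X j : At)
  have hLf : ∀ (c t' : ι → k), Lf c - C (algebraMap k A (∑ j, c j * t' j)) =
      ∑ j, c j • (X j - C (algebraMap k A (t' j))) := by
    intro c t'
    have h1 : C (algebraMap k A (∑ j, c j * t' j)) = ∑ j, c j • (C (algebraMap k A (t' j)) : At) := by
      rw [map_sum, map_sum]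
      refine Finset.sum_congr rfl fun j _ => ?_
      rw [map_mul, map_mul, Algebra.smul_def, IsScalarTower.algebraMap_apply k A At]
      rfl
    rw [h1, ← Finset.sum_sub_distrib]
    simp only [smul_sub]
  let J : Ideal At := 𝔪.map (C : A →+* At) ⊔ Ideal.span (Lf '' (R₀ : Set (ι → k)))
  -- `J̃` lies in every closed point of `V(𝔔̃ + 𝔪At)`
  have hJmax : ∀ 𝔐' : Ideal At, 𝔐'.IsMaximal → 𝔔t ≤ 𝔐' → 𝔪.map (C : A →+* At) ≤ 𝔐' → J ≤ 𝔐' := by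
    intro 𝔐' h𝔐' h𝔔𝔐' h𝔪𝔐'
    obtain ⟨t', 𝔪', h𝔪', hst'2, h𝔐'eq⟩ := hclosed 𝔐' h𝔐' h𝔔𝔐'
    -- `𝔪' = 𝔪`
    have h𝔪𝔪' : 𝔪 = 𝔪' := by
      refine h𝔪max.eq_of_le h𝔪'.ne_top ?_
      intro m hm
      have h1 : C m ∈ 𝔐' := h𝔪𝔐' (Ideal.mem_map_of_mem _ hm)
      rw [h𝔐'eq, Ideal.mem_comap] at h1
      simpa using h1
    subst h𝔪𝔪'
    refine sup_le h𝔪𝔐' ?_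
    rw [Ideal.span_le]
    rintro _ ⟨c, hc, rfl⟩
    have h1 : Lf c - C (algebraMap k A (∑ j, c j * t' j)) ∈ 𝔐' := by
      rw [hLf, h𝔐'eq]
      exact Submodule.sum_mem _ fun j _ => Submodule.smul_of_tower_mem _ (c j) (hgv t' j)
    rwa [hperp c hc t' (hkerK t' hst'2), map_zero, map_zero, sub_zero] at h1
  have hJprime : ∀ 𝔓 : Ideal At, 𝔓.IsPrime → 𝔔t ≤ 𝔓 → 𝔪.map (C : A →+* At) ≤ 𝔓 → J ≤ 𝔓 := by
    intro 𝔓 h𝔓 h𝔔𝔓 h𝔪𝔓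
    rw [← (‹IsJacobsonRing At›).out h𝔓.isRadical, Ideal.jacobson]
    refine le_sInf fun M hM => ?_
    exact hJmax M hM.2 (h𝔔𝔓.trans hM.1) (h𝔪𝔓.trans hM.1)
  have h𝔪𝔐t : 𝔪.map (C : A →+* At) ≤ 𝔐t := by
    rw [h𝔐teq, Ideal.map_le_iff_le_comap]
    intro m hm
    rw [Ideal.mem_comap, Ideal.mem_comap]
    simpa using hm
  have hJ𝔐t : J ≤ 𝔐t := hJmax 𝔐t h𝔐tmax h𝔔𝔐t h𝔪𝔐t
  -- `𝔐̃ = 𝔪At + (aⱼ - tⱼ)ⱼ`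
  have h𝔐tsup : 𝔐t = 𝔪.map (C : A →+* At) ⊔ Ideal.span (Set.range gv) := by
    have hmapC : (𝔪.map (C : A →+* At)).map (evalPoly (A := A) t).toRingHom = 𝔪 := by
      rw [Ideal.map_map]
      have : (evalPoly (A := A) t).toRingHom.comp C = RingHom.id A := by ext a; simp
      rw [this, Ideal.map_id]
    have hker : RingHom.ker (evalPoly (A := A) t).toRingHom = Ideal.span (Set.range gv) :=
      ker_evalPoly t
    rw [h𝔐teq, ← hker]
    conv_lhs => rw [← hmapC]
    rw [Ideal.comap_map_of_surjective (evalPoly (A := A) t).toRingHom (evalPoly_surjective t),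
      ← RingHom.ker_eq_comap_bot]
  -- `𝔐̃ ⧸ J̃` is generated by the `|S|` elements `a_s - t_s`, `s ∈ S`
  let gen : ι → At ⧸ J := fun j => Ideal.Quotient.mk J (gv j)
  have hgen : 𝔐t.map (Ideal.Quotient.mk J) = Ideal.span (gen '' (S : Set ι)) := by
    let ρ : (ι → k) →ₗ[k] At ⧸ J :=
      (Ideal.Quotient.mkₐ k J).toLinearMap ∘ₗ Fintype.linearCombination k gv
    have hρ : ∀ v, ρ v = Ideal.Quotient.mk J (∑ j, v j • gv j) := by
      intro v
      simp only [ρ, LinearMap.coe_comp, Function.comp_apply, Fintype.linearCombination_apply,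
        AlgHom.toLinearMap_apply, Ideal.Quotient.mkₐ_eq_mk]
    have hρsingle : ∀ j, ρ (Pi.single j 1) = gen j := by
      intro j
      rw [hρ, Finset.sum_eq_single j]
      · simp [gen]
      · intro i _ hij; rw [Pi.single_eq_of_ne hij, zero_smul]
      · intro hj; exact absurd (Finset.mem_univ j) hj
    have hρR₀ : ∀ c ∈ R₀, ρ c = 0 := by
      intro c hc
      rw [hρ, ← hLf, hperp c hc t (hkerK t hst2), map_zero, map_zero, sub_zero,
        Ideal.Quotient.eq_zero_iff_mem]
      exact Submodule.mem_sup_right (Ideal.subset_span ⟨c, hc, rfl⟩)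
    apply le_antisymm
    · rw [h𝔐tsup, Ideal.map_sup]
      refine sup_le ?_ ?_
      · rw [(Ideal.map_eq_bot_iff_le_ker _).2 (by rw [Ideal.mk_ker]; exact le_sup_left)]
        exact bot_le
      · rw [Ideal.map_span, Ideal.span_le]
        rintro _ ⟨_, ⟨j, rfl⟩, rfl⟩
        change gen j ∈ Ideal.span (gen '' (S : Set ι))
        obtain ⟨r, hr, w, hw, hrw⟩ := Submodule.mem_sup.1 (hspan j)
        have hgj : gen j = ρ w := by rw [← hρsingle, ← hrw, map_add, hρR₀ r hr, zero_add]
        rw [hgj]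
        have hw' : ρ w ∈ Submodule.span k
            (ρ '' ((fun s => (Pi.single s (1 : k) : ι → k)) '' (S : Set ι))) := by
          rw [← Submodule.map_span]
          exact Submodule.mem_map_of_mem hw
        have hle : Submodule.span k (ρ '' ((fun s => (Pi.single s (1 : k) : ι → k)) '' (S : Set ι)))
            ≤ (Ideal.span (gen '' (S : Set ι))).restrictScalars k := by
          rw [Submodule.span_le]
          rintro _ ⟨_, ⟨s', hs', rfl⟩, rfl⟩
          change ρ (Pi.single s' 1) ∈ Ideal.span (gen '' (S : Set ι))
          rw [hρsingle]
          exact Ideal.subset_span ⟨s', hs', rfl⟩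
        exact hle hw'
    · rw [Ideal.span_le]
      rintro _ ⟨s', -, rfl⟩
      refine Ideal.mem_map_of_mem _ ?_
      rw [h𝔐teq]; exact hgv t s'
  -- `ht (𝔐̃ ⧸ J̃) ≤ |S|` by Krull's height theorem
  haveI := h𝔐tmax
  haveI hMJ : (𝔐t.map (Ideal.Quotient.mk J)).IsPrime := isPrime_map_mk J 𝔐t hJ𝔐t
  have hhJ : (𝔐t.map (Ideal.Quotient.mk J)).height ≤ S.card := by
    have hspanJ : 𝔐t.map (Ideal.Quotient.mk J) = Ideal.span (↑(S.image gen) : Set (At ⧸ J)) := by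
      rw [hgen, Finset.coe_image]
    have hmin : 𝔐t.map (Ideal.Quotient.mk J) ∈
        (Ideal.span (↑(S.image gen) : Set (At ⧸ J))).minimalPrimes := by
      rw [← hspanJ, Ideal.minimalPrimes_eq_subsingleton_self]; exact Set.mem_singleton _
    exact (Ideal.height_le_card_of_mem_minimalPrimes_span_finset hmin).trans
      (by exact_mod_cast Finset.card_image_le)
  -- comparison `ht (𝔐̃ ⧸ (𝔔̃ + 𝔪At)) ≤ ht (𝔐̃ ⧸ J̃)` along `V(𝔔̃ + 𝔪At) ⊆ V(J̃)`
  set K₂ : Ideal At := 𝔔t ⊔ 𝔪.map (C : A →+* At) with hK₂def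
  have hK₂𝔐t : K₂ ≤ 𝔐t := sup_le h𝔔𝔐t h𝔪𝔐t
  haveI hMK₂ : (𝔐t.map (Ideal.Quotient.mk K₂)).IsPrime := isPrime_map_mk K₂ 𝔐t hK₂𝔐t
  let pre : Ideal (At ⧸ K₂) → Ideal At := fun I => I.comap (Ideal.Quotient.mk K₂)
  have hpreK₂ : ∀ I, K₂ ≤ pre I := fun I x hx => by
    change Ideal.Quotient.mk K₂ x ∈ I
    rw [Ideal.Quotient.eq_zero_iff_mem.2 hx]; exact zero_mem _
  have hpremono : StrictMono pre :=
    Monotone.strictMono_of_injective (fun I I' h => Ideal.comap_mono h)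
      (Ideal.comap_injective_of_surjective _ Ideal.Quotient.mk_surjective)
  have hpreJ : ∀ q : PrimeSpectrum (At ⧸ K₂), J ≤ pre q.asIdeal := fun q =>
    hJprime _ (Ideal.comap_isPrime _ _) (le_sup_left.trans (hpreK₂ _))
      (le_sup_right.trans (hpreK₂ _))
  let f : PrimeSpectrum (At ⧸ K₂) → PrimeSpectrum (At ⧸ J) := fun q =>
    ⟨(pre q.asIdeal).map (Ideal.Quotient.mk J),
      @isPrime_map_mk _ _ J (pre q.asIdeal) (Ideal.comap_isPrime _ _) (hpreJ q)⟩
  have hf : StrictMono f := by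
    intro q q' hqq'
    have h1 : pre q.asIdeal < pre q'.asIdeal := hpremono hqq'
    change (pre q.asIdeal).map (Ideal.Quotient.mk J) < (pre q'.asIdeal).map (Ideal.Quotient.mk J)
    refine lt_of_le_of_ne (Ideal.map_mono h1.le) fun heq => h1.ne ?_
    have h2 := congrArg (Ideal.comap (Ideal.Quotient.mk J)) heq
    rwa [Ideal.comap_map_of_surjective _ Ideal.Quotient.mk_surjective,
      Ideal.comap_map_of_surjective _ Ideal.Quotient.mk_surjective, ← RingHom.ker_eq_comap_bot,
      Ideal.mk_ker, sup_eq_left.2 (hpreJ q), sup_eq_left.2 (hpreJ q')] at h2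
  have hU3 : (𝔐t.map (Ideal.Quotient.mk K₂)).height ≤ (𝔐t.map (Ideal.Quotient.mk J)).height := by
    have hh := Order.height_le_height_apply_of_strictMono f hf ⟨𝔐t.map (Ideal.Quotient.mk K₂), hMK₂⟩
    rw [← PrimeSpectrum.height_eq_orderHeight, ← PrimeSpectrum.height_eq_orderHeight] at hh
    have hfM : (f ⟨𝔐t.map (Ideal.Quotient.mk K₂), hMK₂⟩).asIdeal = 𝔐t.map (Ideal.Quotient.mk J) := by
      change ((𝔐t.map (Ideal.Quotient.mk K₂)).comap (Ideal.Quotient.mk K₂)).map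
        (Ideal.Quotient.mk J) = _
      rw [Ideal.comap_map_of_surjective _ Ideal.Quotient.mk_surjective, ← RingHom.ker_eq_comap_bot,
        Ideal.mk_ker, sup_eq_left.2 hK₂𝔐t]
    rwa [hfM] at hh
  -- the count
  have h1 : (𝔐t.map (Ideal.Quotient.mk K₂)).height ≤ (S.card : ℕ∞) := hU3.trans hhJ
  calc (𝔐t.map (Ideal.Quotient.mk K₂)).height +
        (Module.finrank k (LinearMap.range (linCombQuotSq (k := k) u 𝔪)) : ℕ∞)
      ≤ (S.card : ℕ∞) + (Module.finrank k (LinearMap.range Λ) : ℕ∞) := add_le_add h1 le_rfl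
    _ = (Fintype.card ι : ℕ∞) := by exact_mod_cast hcard

end Summit.ResolutionOfSingularities.ResolutionOfSingularities.Cruxes.EquisingularLift.StrataSplit

end
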